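import Mathlib
import Summits.ValiantsHypothesis.ValiantsHypothesis.Theorems.SymPencilEquivariantSdcNotQPPermifyReduction
import Summits.ValiantsHypothesis.ValiantsHypothesis.Theorems.SymPencilEquivariantSdcNotQPPermEmbeddingRegular
import HarnessLib

/-!
# ValiantsHypothesis / SymPencil — crux `EquivariantSdcNotQP` (stmt-ValiantsHypothesis-17792),
# line `birth_EquivariantSdcNotQP`: `stub_permify` at EXPONENTIAL cost, from (ii′) (helper)

`permify_exponential_of_finiteLift`: composing the steps of the line's `stub_permify` —
(i) `conjugationNormalForm_rename` (`…PermifyReduction.lean`, landed), (ii′) FINITE CONJUGATION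
LIFT taken as the hypothesis `h₂` VERBATIM (it is the tree theorem `finiteConjugationLift` of
`…FiniteConjugationLift.lean`, p584870; this file does not import that module only because its
compiled interface was not yet available on the build farm when this was written — the
unconditional one-liner `permify_exponential := permify_exponential_of_finiteLift
finiteConjugationLift` belongs in `…PermifyExponential.lean`), (iii-exp)
`PermEmbedding.permEmbedding_regular` (`…PermEmbeddingRegular.lean`, the averaging retraction
into `ℂ[F × [m₀]]`, landed) and (iv) `exists_permConj_extension` (landed) — every
`Γ_n`-equivariant affine determinantal representation of
`per_n` of size `m` (LINEAR lifts of the row/column permutation pairs) yields an affine pencil of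
size `m' ≤ m² · (n!)²` with `det = per_n` on which every substitution `x_{ij} ↦ x_{π i, ρ j}` acts by
conjugation with a PERMUTATION matrix.  This is the conclusion of the registered stub
`stub_permify` with its quasi-polynomial budget `2^{(log₂ m + d)^d}` replaced by `m² (n!)²` (and
without the symmetry hypothesis, which the reduction never used): the open content of
`stub_permify` is exactly the BUDGET, i.e. piece (iii′) `PermEmbeddingQP` for small pencils
(`…PermEmbeddingRegular.lean :: permEmbeddingQP_of_large` covers `log₂ m₀ ≳ √(2 n log₂ n)`).

Honest framing: `stub_permify`, the crux `EquivariantSdcNotQP` and `VP ≠ VNP` remain OPEN; an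
exponential-size symmetric model carries no lower-bound transfer.  Helper file
(`--supports stmt-ValiantsHypothesis-17792 --as helper`); 0 definitions, 0 named facts.
-/

noncomputable section

set_option linter.dupNamespace false

namespace Summit.ValiantsHypothesis.ValiantsHypothesis.Theorems.SymPencilEquivariantSdcNotQP

open Matrix MvPolynomial Literature.Computability.AlgebraicComplexity

/-- **`stub_permify` at exponential cost, from (ii′).**  Granted the finite conjugation lift
(hypothesis `h₂` = piece (ii′) verbatim = the tree theorem `finiteConjugationLift`), a `Γ_n`-equivariant affine
determinantal representation of `per_n` of size `m` (linear lifts for the row/column permutation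
pairs) yields an affine pencil `A'` of size `m' ≤ m² · (n!)²` with `det A' = per_n` on which every
substitution `x_{ij} ↦ x_{π i, ρ j}` is undone by conjugation with a PERMUTATION matrix.  This is the
conclusion of the registered stub `stub_permify` of the line `birth_EquivariantSdcNotQP` with its
quasi-polynomial budget `2^{(log₂ m + d)^d}` replaced by `m² (n!)²` (and without the symmetry
hypothesis): steps (i) `conjugationNormalForm_rename`, (ii′) = `h₂`,
(iii-exp) `PermEmbedding.permEmbedding_regular`, (iv) `exists_permConj_extension`.  Honest framing:
the quasi-polynomial budget — piece (iii′) for small pencils — is the open content of `stub_permify`;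
the crux `EquivariantSdcNotQP` and `VP ≠ VNP` remain OPEN. [folklore] -/
theorem permify_exponential_of_finiteLift
    (h₂ : ∀ (n m : ℕ) (B : Matrix (Fin m) (Fin m) (MvPolynomial (Fin n × Fin n) ℂ)),
      IsAffineDetRepr (perPoly (Fin n) ℂ) B →
      (∃ c : ℂ, c ≠ 0 ∧
        B.map (MvPolynomial.eval fun _ => (1 : ℂ)) = c • (1 : Matrix (Fin m) (Fin m) ℂ)) →
      (∀ π ρ : Equiv.Perm (Fin n), ∃ g : GL (Fin m) ℂ,
        B.map (MvPolynomial.rename fun ij : Fin n × Fin n => (π ij.1, ρ ij.2)) =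
          ((g⁻¹ : GL (Fin m) ℂ) : Matrix (Fin m) (Fin m) ℂ).map MvPolynomial.C * B *
            (g : Matrix (Fin m) (Fin m) ℂ).map MvPolynomial.C) →
      ∃ m₀ ≤ m, ∃ (B₀ : Matrix (Fin m₀) (Fin m₀) (MvPolynomial (Fin n × Fin n) ℂ))
        (F : Subgroup ((Equiv.Perm (Fin n) × Equiv.Perm (Fin n)) × GL (Fin m₀) ℂ)),
        IsAffineDetRepr (perPoly (Fin n) ℂ) B₀ ∧
        (∀ π ρ : Equiv.Perm (Fin n), ∃ g : GL (Fin m₀) ℂ, ((π, ρ), g) ∈ F) ∧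
        (∀ g : GL (Fin m₀) ℂ, ((1 : Equiv.Perm (Fin n) × Equiv.Perm (Fin n)), g) ∈ F →
          ∃ c : ℂ, (g : Matrix (Fin m₀) (Fin m₀) ℂ) = c • (1 : Matrix (Fin m₀) (Fin m₀) ℂ)) ∧
        (∀ x ∈ F, Matrix.det (x.2 : Matrix (Fin m₀) (Fin m₀) ℂ) = 1) ∧
        (∀ x ∈ F, B₀.map (MvPolynomial.rename fun ij : Fin n × Fin n => (x.1.1 ij.1, x.1.2 ij.2)) =
          ((x.2⁻¹ : GL (Fin m₀) ℂ) : Matrix (Fin m₀) (Fin m₀) ℂ).map MvPolynomial.C * B₀ *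
            (x.2 : Matrix (Fin m₀) (Fin m₀) ℂ).map MvPolynomial.C))
    (n m : ℕ) (A : Matrix (Fin m) (Fin m) (MvPolynomial (Fin n × Fin n) ℂ))
    (hA : IsEquivariantDetRepr (Subgroup.closure {γ : GL (Fin n × Fin n) ℂ |
        ∃ π ρ : Equiv.Perm (Fin n), (γ : Matrix (Fin n × Fin n) (Fin n × Fin n) ℂ) =
          Equiv.Perm.permMatrix ℂ (Equiv.prodCongr π ρ)}) (perPoly (Fin n) ℂ) A) :
    ∃ m' ≤ m ^ 2 * (Nat.factorial n) ^ 2,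
      ∃ A' : Matrix (Fin m') (Fin m') (MvPolynomial (Fin n × Fin n) ℂ),
        IsAffineDetRepr (perPoly (Fin n) ℂ) A' ∧
        ∀ π ρ : Equiv.Perm (Fin n), ∃ σ : Equiv.Perm (Fin m'),
          A'.map (MvPolynomial.rename fun ij : Fin n × Fin n => (π ij.1, ρ ij.2)) =
            (σ.permMatrix ℂ).map MvPolynomial.C * A' * ((σ.permMatrix ℂ)ᵀ).map MvPolynomial.C := by
  classical
  -- step (i): conjugation normal form
  obtain ⟨B, hB, hBJ, hgen⟩ := conjugationNormalForm_rename n m A hA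
  -- step (ii′): finite conjugation lift
  obtain ⟨m₀, hm₀, B₀, F, hB₀, hsurj, hscal, hdet, hliftF⟩ := h₂ n m B hB hBJ hgen
  -- step (iii) at exponential cost: the regular (averaging) embedding
  obtain ⟨m', hm', ι, p, τ, hpι, hrel⟩ := PermEmbedding.permEmbedding_regular n m₀ F hscal hdet
  -- step (iv): extension by the identity
  obtain ⟨A', hA'deg, hA'det, hA'perm⟩ := exists_permConj_extension
    (fun πρ : Equiv.Perm (Fin n) × Equiv.Perm (Fin n) =>
      MvPolynomial.rename fun ij : Fin n × Fin n => (πρ.1 ij.1, πρ.2 ij.2))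
    B₀ hB₀.1 ι p hpι (fun πρ => by
      obtain ⟨π, ρ⟩ := πρ
      obtain ⟨g, hg⟩ := hsurj π ρ
      exact ⟨g, τ ((π, ρ), g), hliftF ((π, ρ), g) hg, (hrel ((π, ρ), g) hg).1,
        (hrel ((π, ρ), g) hg).2⟩)
  refine ⟨m', ?_, A', ⟨hA'deg, hA'det.trans hB₀.2⟩, fun π ρ => hA'perm (π, ρ)⟩
  calc m' ≤ m₀ ^ 2 * (Nat.factorial n) ^ 2 := hm'
    _ ≤ m ^ 2 * (Nat.factorial n) ^ 2 := Nat.mul_le_mul_right _ (Nat.pow_le_pow_left hm₀ 2)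

end Summit.ValiantsHypothesis.ValiantsHypothesis.Theorems.SymPencilEquivariantSdcNotQP

end
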